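import Summits.CriticalPhenomena.Ising3DConformalLimit.Theses.OctaveForgetting
import Literature.Probability.LatticeModels.GibbsSpecificationProofs
import Literature.Probability.LatticeModels.GibbsSpecificationDLRProofs
import Literature.Probability.LatticeModels.CoarseCellMixingDLR
import Literature.Probability.Moments.CovarianceFreezing

/-!
# `ForgettingComposes` — maximal correlations multiply along the shell Markov chain

Route `OctaveForgetting` of `Ising3DConformalLimit`, support item stmt-CriticalPhenomena-8104
(`Summit.CriticalPhenomena.Ising3DConformalLimit.Theses.OctaveForgetting.ForgettingComposes`):
for a Gibbs measure `μ` of the n.n. Ising specification on `ℤ³` at `(β_c(3), 0)`, a ratio `L ≥ 2`,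
`r₀ ≥ 1` and `θ ≥ 0`, if every pair of lattice spheres `(S_r, S_{Lr})`, `r ≥ r₀`, satisfies
`Cov(f,g)² ≤ θ · Var f · Var g` for `f`, `g` measurable with respect to the two spheres, then
`Cov(σ₀, g)² ≤ θ^k · Var σ₀ · Var g` for every `g` depending on the spins of `S_{L^k r₀}`.

Proof (Witsenhausen's product rule for maximal correlation along a Markov chain, here the exact
DLR Markov chain `σ₀ → S_{r₀} → S_{L r₀} → …`): induction on `k`. For the step let `R = L^k r₀`,
`Λ = {x : ∑ xᵢ² < R²}` (a finite ball containing `0`) and `h(η) = γ_Λ(σ₀ | η)`. The outer boundary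
of `Λ` in `ℤ³` lies in the sphere `S_R = {R² ≤ ∑ xᵢ² < (R+1)²}`, so `h` depends only on the spins
of `S_R` (`isingExpect_fixed_congr_outerBoundary`); `S_R` and `S_{LR}` lie outside `Λ`, so the DLR
equation and properness give `∫ σ₀ g dμ = ∫ h g dμ` for every `g` depending on `Λᶜ`
(`IsGibbsMeasure.integral_integral_eq`, `kernel_integral_mul_of_dependsOn`). Hence
`Cov(σ₀, g) = Cov(h, g)` and `Cov(σ₀, h) = Var h`; the pair hypothesis gives
`Cov(h,g)² ≤ θ Var h Var g` and the induction hypothesis at `h` gives `Var h ≤ θ^k Var σ₀`.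
The base case is the Cauchy–Schwarz inequality
(`Literature.Probability.Moments.covariance_sq_le_variance_mul`). All functions of finitely many
`ℤˣ`-valued spins are bounded and measurable, so no integrability hypotheses are needed.

References: H. S. Witsenhausen, SIAM J. Appl. Math. 28 (1975) 100–113 (doi:10.1137/0128010);
H.-O. Georgii, *Gibbs Measures and Phase Transitions* (2011), Rem. 1.24; Friedli–Velenik (2017),
§3.6.3, eq. (3.26) and Lemma 6.13.
-/

namespace Summit.CriticalPhenomena.Ising3DConformalLimit.Theorems

open MeasureTheory ProbabilityTheory Literature.Probability.LatticeModels

/-! ### Functions of finitely many spins -/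

section Spins

variable {V : Type*}

/-- A real function of the spins in a finite set of sites is measurable for the product
σ-algebra (it factors through the restriction to the finite discrete space `s → ℤˣ`). -/
theorem forgettingComposes_measurable_of_dependsOn {s : Set V} (hs : s.Finite)
    {g : SpinConfig V → ℝ} (hg : DependsOn g s) : Measurable g := by
  obtain ⟨G, hG⟩ := dependsOn_iff_exists_comp.1 hg
  haveI : Finite s := hs.to_subtype
  rw [hG]
  exact (measurable_of_finite G).comp (Set.measurable_restrict s)

/-- A real function of the spins in a finite set of sites is bounded (it takes finitely many
values). -/
theorem forgettingComposes_exists_bound_of_dependsOn {s : Set V} (hs : s.Finite)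
    {g : SpinConfig V → ℝ} (hg : DependsOn g s) : ∃ C : ℝ, ∀ σ, |g σ| ≤ C := by
  obtain ⟨G, hG⟩ := dependsOn_iff_exists_comp.1 hg
  haveI : Finite s := hs.to_subtype
  obtain ⟨τ₀, hτ₀⟩ := Finite.exists_max fun τ : (s → ℤˣ) => |G τ|
  refine ⟨|G τ₀|, fun σ => ?_⟩
  rw [hG]
  exact hτ₀ _

/-- A bounded measurable real function is integrable under a probability measure. -/
theorem forgettingComposes_integrable_of_abs_le {Ω : Type*} [MeasurableSpace Ω] {μ : Measure Ω}
    [IsProbabilityMeasure μ] {f : Ω → ℝ} (hf : Measurable f) {C : ℝ} (hC : ∀ ω, |f ω| ≤ C) :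
    Integrable f μ :=
  (integrable_const C).mono' hf.aestronglyMeasurable
    (ae_of_all _ fun ω => by rw [Real.norm_eq_abs]; exact hC ω)

/-- A bounded measurable real function is square integrable under a probability measure. -/
theorem forgettingComposes_memLp_two_of_abs_le {Ω : Type*} [MeasurableSpace Ω] {μ : Measure Ω}
    [IsProbabilityMeasure μ] {f : Ω → ℝ} (hf : Measurable f) {C : ℝ} (hC : ∀ ω, |f ω| ≤ C) :
    MemLp f 2 μ :=
  MemLp.of_bound hf.aestronglyMeasurable C
    (ae_of_all _ fun ω => by rw [Real.norm_eq_abs]; exact hC ω)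

/-- **Cauchy–Schwarz for the covariance**, raw-integral form: for bounded measurable `f`, `g`
on a probability space, `(∫ fg − ∫ f ∫ g)² ≤ (∫ f² − (∫ f)²)(∫ g² − (∫ g)²)`. -/
theorem forgettingComposes_cov_sq_le_var_mul_var {Ω : Type*} [MeasurableSpace Ω] {μ : Measure Ω}
    [IsProbabilityMeasure μ] {f g : Ω → ℝ} (hf : Measurable f) (hg : Measurable g) {Cf Cg : ℝ}
    (hCf : ∀ ω, |f ω| ≤ Cf) (hCg : ∀ ω, |g ω| ≤ Cg) :
    (∫ ω, f ω * g ω ∂μ - (∫ ω, f ω ∂μ) * (∫ ω, g ω ∂μ)) ^ 2 ≤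
      (∫ ω, f ω ^ 2 ∂μ - (∫ ω, f ω ∂μ) ^ 2) * (∫ ω, g ω ^ 2 ∂μ - (∫ ω, g ω ∂μ) ^ 2) := by
  have hf2 : MemLp f 2 μ := forgettingComposes_memLp_two_of_abs_le hf hCf
  have hg2 : MemLp g 2 μ := forgettingComposes_memLp_two_of_abs_le hg hCg
  have h := Literature.Probability.Moments.covariance_sq_le_variance_mul hf2 hg2
  rw [covariance_eq_sub hf2 hg2, variance_eq_sub hf2, variance_eq_sub hg2] at h
  simpa only [Pi.mul_apply, Pi.pow_apply] using h

/-- The variance `∫ f² − (∫ f)²` of a bounded measurable function on a probability space is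
nonnegative. -/
theorem forgettingComposes_var_nonneg {Ω : Type*} [MeasurableSpace Ω] {μ : Measure Ω}
    [IsProbabilityMeasure μ] {f : Ω → ℝ} (hf : Measurable f) {C : ℝ} (hC : ∀ ω, |f ω| ≤ C) :
    0 ≤ ∫ ω, f ω ^ 2 ∂μ - (∫ ω, f ω ∂μ) ^ 2 := by
  have hf2 : MemLp f 2 μ := forgettingComposes_memLp_two_of_abs_le hf hC
  have h := variance_nonneg f μ
  rw [variance_eq_sub hf2] at h
  simpa only [Pi.pow_apply] using h

/-- **DLR resampling of a single spin**: for a Gibbs measure `μ` of a specification `γ` on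
`V → ℤˣ`, a finite volume `Λ` and a bounded measurable `g` depending only on the spins off `Λ`,
`∫ σ_{x₀} g dμ = ∫ γ_Λ(σ_{x₀} | η) g(η) dμ(η)` (DLR equation plus properness). -/
theorem forgettingComposes_integral_spinAt_mul {γ : Specification V ℤˣ} (hγ : IsSpecification γ)
    {μ : Measure (SpinConfig V)} (hμ : IsGibbsMeasure γ μ) (Λ : Finset V) (x₀ : V)
    {g : SpinConfig V → ℝ} (hgm : Measurable g) {C : ℝ} (hC : ∀ σ, |g σ| ≤ C)
    (hg : DependsOn g ((↑Λ : Set V)ᶜ)) :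
    ∫ σ, spinAt x₀ σ * g σ ∂μ = ∫ η, (∫ σ, spinAt x₀ σ ∂(γ Λ η)) * g η ∂μ := by
  haveI := hμ.isProbabilityMeasure
  have hint : Integrable (fun σ => spinAt x₀ σ * g σ) μ := by
    refine forgettingComposes_integrable_of_abs_le ((measurable_spinAt x₀).mul hgm) (C := C)
      fun σ => ?_
    rw [abs_mul, abs_spinAt, one_mul]
    exact hC σ
  rw [← hμ.integral_integral_eq hγ Λ hint]
  refine integral_congr_ae (ae_of_all _ fun η => ?_)
  show ∫ σ, spinAt x₀ σ * g σ ∂(γ Λ η) = (∫ σ, spinAt x₀ σ ∂(γ Λ η)) * g η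
  rw [kernel_integral_mul_of_dependsOn hγ Λ hg η, mul_comm]

end Spins

/-! ### Lattice geometry of balls and spheres in `ℤ³` -/

section Geometry

/-- `∑ⱼ (x + c eᵢ)ⱼ² = ∑ⱼ xⱼ² + 2 c xᵢ + c²` on `ℤ³`. -/
theorem forgettingComposes_sum_sq_add_single (x : Site 3) (i : Fin 3) (c : ℤ) :
    ∑ j, (x + Pi.single i c : Site 3) j ^ 2 = ∑ j, x j ^ 2 + 2 * c * x i + c ^ 2 := by
  simp only [Fin.sum_univ_three, Pi.add_apply]
  fin_cases i <;> simp <;> ring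

/-- Sub-level sets `{x : ∑ xᵢ² < M}` of the squared Euclidean norm on `ℤ³` are finite. -/
theorem forgettingComposes_finite_sum_sq_lt (M : ℤ) :
    Set.Finite {x : Site 3 | ∑ i, x i ^ 2 < M} := by
  refine (Set.Finite.pi' (t := fun _ : Fin 3 => Set.Icc (-M) M)
    fun _ => Set.finite_Icc _ _).subset ?_
  intro x hx i
  simp only [Set.mem_setOf_eq] at hx
  have h1 : x i ^ 2 ≤ ∑ j, x j ^ 2 :=
    Finset.single_le_sum (fun j _ => sq_nonneg (x j)) (Finset.mem_univ i)
  have h2 : |x i| ≤ x i ^ 2 := by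
    rw [← Int.natCast_natAbs]
    exact Int.natAbs_le_self_sq _
  simp only [Set.mem_Icc]
  constructor
  · linarith [neg_abs_le (x i)]
  · linarith [le_abs_self (x i)]

/-- The lattice sphere `S_R = {x ∈ ℤ³ : R² ≤ ∑ xᵢ² < (R+1)²}` is finite. -/
theorem forgettingComposes_sphere_finite (R : ℕ) :
    Set.Finite {x : Site 3 | (R : ℤ) ^ 2 ≤ ∑ i, x i ^ 2 ∧ ∑ i, x i ^ 2 < ((R : ℤ) + 1) ^ 2} :=
  (forgettingComposes_finite_sum_sq_lt (((R : ℤ) + 1) ^ 2)).subset fun _ hx => hx.2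

/-- The outer vertex boundary in `ℤ³` of the ball `Λ = {x : ∑ xᵢ² < R²}` lies in the sphere
`S_R = {R² ≤ ∑ xᵢ² < (R+1)²}`: a neighbour `y = x ± eᵢ` of a point `x` of the ball has
`∑ yⱼ² = ∑ xⱼ² ± 2xᵢ + 1 ≤ (R² − 1) + 2(R − 1) + 1 < (R + 1)²`. -/
theorem forgettingComposes_outerBoundary_subset_sphere (R : ℕ) (Λ : Finset (Site 3))
    (hΛ : ∀ x, x ∈ Λ ↔ ∑ i, x i ^ 2 < (R : ℤ) ^ 2) :
    ∀ y ∈ outerBoundary (zdGraph 3) Λ,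
      (R : ℤ) ^ 2 ≤ ∑ i, y i ^ 2 ∧ ∑ i, y i ^ 2 < ((R : ℤ) + 1) ^ 2 := by
  intro y hy
  rw [mem_outerBoundary_iff] at hy
  obtain ⟨hyΛ, x, hxΛ, hadj⟩ := hy
  rw [hΛ] at hyΛ hxΛ
  refine ⟨not_lt.1 hyΛ, ?_⟩
  have hR0 : (0 : ℤ) ≤ R := Int.natCast_nonneg R
  rw [zdGraph_adj_iff] at hadj
  obtain ⟨i, h | h⟩ := hadj
  · -- `x = y + eᵢ`, i.e. `y = x + (-1) eᵢ`
    have hy' : y = x + Pi.single i (-1) := by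
      rw [h, add_assoc, ← Pi.single_add, add_neg_cancel, Pi.single_zero, add_zero]
    have hxi : x i ^ 2 ≤ ∑ j, x j ^ 2 :=
      Finset.single_le_sum (fun j _ => sq_nonneg (x j)) (Finset.mem_univ i)
    have habs := abs_lt_of_sq_lt_sq' (lt_of_le_of_lt hxi hxΛ) hR0
    rw [hy', forgettingComposes_sum_sq_add_single]
    linarith [habs.1]
  · -- `y = x + eᵢ`
    have hxi : x i ^ 2 ≤ ∑ j, x j ^ 2 :=
      Finset.single_le_sum (fun j _ => sq_nonneg (x j)) (Finset.mem_univ i)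
    have habs := abs_lt_of_sq_lt_sq' (lt_of_le_of_lt hxi hxΛ) hR0
    rw [h, forgettingComposes_sum_sq_add_single]
    linarith [habs.2]

end Geometry

/-! ### The theorem -/

/-- **`ForgettingComposes`** (item stmt-CriticalPhenomena-8104 of route `OctaveForgetting`):
maximal correlations multiply along the exact DLR Markov chain of nested lattice spheres — if
every pair `(S_r, S_{Lr})`, `r ≥ r₀`, satisfies `Cov² ≤ θ · Var · Var` under the critical Gibbs
measure `μ`, then `Cov_μ(σ₀, g)² ≤ θ^k · Var_μ(σ₀) · Var_μ(g)` for every `g` depending on the spins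
of `S_{L^k r₀}` (Witsenhausen 1975; Georgii 2011, Rem. 1.24). -/
theorem forgettingComposes_proof :
    Summit.CriticalPhenomena.Ising3DConformalLimit.Theses.OctaveForgetting.ForgettingComposes := by
  unfold Summit.CriticalPhenomena.Ising3DConformalLimit.Theses.OctaveForgetting.ForgettingComposes
  intro μ hμ L r₀ θ hL hr₀ hθ hpair k
  -- the Ising specification on `ℤ³` at `(β_c(3), 0)` and the Gibbs property of `μ`
  have hγ : IsSpecification (isingSpecification (zdGraph 3) (criticalBeta 3) 0) :=
    isSpecification_isingSpecification_zd_holds 3 (criticalBeta 3) 0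
  have hμG : IsGibbsMeasure (isingSpecification (zdGraph 3) (criticalBeta 3) 0) μ := hμ
  haveI := hμG.isProbabilityMeasure
  have hσm : Measurable (spinAt (0 : Site 3)) := measurable_spinAt 0
  have hσb : ∀ σ : SpinConfig (Site 3), |spinAt 0 σ| ≤ 1 := fun σ => (abs_spinAt 0 σ).le
  induction k with
  | zero =>
    -- base case: Cauchy–Schwarz
    intro g hg
    have hfin := forgettingComposes_sphere_finite (L ^ 0 * r₀)
    have hgm : Measurable g := forgettingComposes_measurable_of_dependsOn hfin hg
    obtain ⟨Cg, hCg⟩ := forgettingComposes_exists_bound_of_dependsOn hfin hg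
    rw [pow_zero, one_mul]
    exact forgettingComposes_cov_sq_le_var_mul_var hσm hgm hσb hCg
  | succ k ih =>
    intro g hg
    -- radii: `R = L^k r₀`, the sphere of `g` has radius `L R`
    set R : ℕ := L ^ k * r₀ with hRdef
    have hL0 : 0 < L := by omega
    have hR0 : 0 < R := Nat.mul_pos (pow_pos hL0 k) (by omega)
    have hRr : r₀ ≤ R := Nat.le_mul_of_pos_left r₀ (pow_pos hL0 k)
    have hLR : L ^ (k + 1) * r₀ = L * R := by rw [hRdef]; ring
    rw [hLR] at hg
    -- the ball `Λ = {∑ xᵢ² < R²}`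
    obtain ⟨Λ, hmemΛ⟩ : ∃ Λ : Finset (Site 3), ∀ x, x ∈ Λ ↔ ∑ i, x i ^ 2 < (R : ℤ) ^ 2 :=
      ⟨(forgettingComposes_finite_sum_sq_lt ((R : ℤ) ^ 2)).toFinset, fun x => by
        rw [Set.Finite.mem_toFinset]; rfl⟩
    have h0Λ : (0 : Site 3) ∈ Λ := by
      rw [hmemΛ]
      have h0 : ∑ i : Fin 3, (0 : Site 3) i ^ 2 = 0 := by simp
      rw [h0]
      exact pow_pos (Int.natCast_pos.2 hR0) 2
    -- the spheres `S_R`, `S_{LR}` are finite and lie outside `Λ`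
    have hSfin := forgettingComposes_sphere_finite R
    have hSLfin := forgettingComposes_sphere_finite (L * R)
    have hSout : {x : Site 3 | (R : ℤ) ^ 2 ≤ ∑ i, x i ^ 2 ∧ ∑ i, x i ^ 2 < ((R : ℤ) + 1) ^ 2} ⊆
        (↑Λ : Set (Site 3))ᶜ := by
      intro x hx hxΛ
      exact not_lt.2 hx.1 ((hmemΛ x).1 (Finset.mem_coe.1 hxΛ))
    have hRLR : (R : ℤ) ^ 2 ≤ ((L * R : ℕ) : ℤ) ^ 2 := by
      have h1 : (R : ℤ) ≤ ((L * R : ℕ) : ℤ) := by exact_mod_cast Nat.le_mul_of_pos_left R hL0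
      have h2 : (0 : ℤ) ≤ R := Int.natCast_nonneg R
      exact sq_le_sq' (by linarith) h1
    have hSLout : {x : Site 3 | ((L * R : ℕ) : ℤ) ^ 2 ≤ ∑ i, x i ^ 2 ∧
        ∑ i, x i ^ 2 < (((L * R : ℕ) : ℤ) + 1) ^ 2} ⊆ (↑Λ : Set (Site 3))ᶜ := by
      intro x hx hxΛ
      exact not_lt.2 (hRLR.trans hx.1) ((hmemΛ x).1 (Finset.mem_coe.1 hxΛ))
    -- `h = γ_Λ(σ₀ | ·)` depends only on the spins of `S_R` (outer boundary of `Λ`)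
    set h : SpinConfig (Site 3) → ℝ := fun η =>
      ∫ σ, spinAt 0 σ ∂(isingSpecification (zdGraph 3) (criticalBeta 3) 0 Λ η) with hhdef
    have hbd := forgettingComposes_outerBoundary_subset_sphere R Λ hmemΛ
    have hhdep : DependsOn h
        {x : Site 3 | (R : ℤ) ^ 2 ≤ ∑ i, x i ^ 2 ∧ ∑ i, x i ^ 2 < ((R : ℤ) + 1) ^ 2} := by
      intro η η' hηη'
      change isingExpect (zdGraph 3) Λ (criticalBeta 3) 0 (.fixed η) (spinAt 0) =
        isingExpect (zdGraph 3) Λ (criticalBeta 3) 0 (.fixed η') (spinAt 0)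
      refine isingExpect_fixed_congr_outerBoundary (zdGraph 3)
        (fun y hy => hηη' y (hbd y hy)) _ _ hσm ?_
      intro σ σ' hσσ'
      simp only [spinAt, hσσ' 0 h0Λ]
    have hhm : Measurable h := forgettingComposes_measurable_of_dependsOn hSfin hhdep
    obtain ⟨Ch, hCh⟩ := forgettingComposes_exists_bound_of_dependsOn hSfin hhdep
    have hgm : Measurable g := forgettingComposes_measurable_of_dependsOn hSLfin hg
    obtain ⟨Cg, hCg⟩ := forgettingComposes_exists_bound_of_dependsOn hSLfin hg
    -- DLR identities: `∫ σ₀ g = ∫ h g`, `∫ σ₀ = ∫ h`, `∫ σ₀ h = ∫ h²`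
    have hI1 : ∫ σ, spinAt 0 σ * g σ ∂μ = ∫ η, h η * g η ∂μ :=
      forgettingComposes_integral_spinAt_mul hγ hμG Λ 0 hgm hCg (hg.mono hSLout)
    have hI2 : ∫ σ, spinAt 0 σ ∂μ = ∫ η, h η ∂μ :=
      (hμG.integral_integral_eq hγ Λ (forgettingComposes_integrable_of_abs_le hσm hσb)).symm
    have hI3 : ∫ σ, spinAt 0 σ * h σ ∂μ = ∫ η, h η * h η ∂μ :=
      forgettingComposes_integral_spinAt_mul hγ hμG Λ 0 hhm hCh (hhdep.mono hSout)
    have hcov : ∫ σ, spinAt 0 σ * g σ ∂μ - (∫ σ, spinAt 0 σ ∂μ) * ∫ σ, g σ ∂μ =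
        ∫ η, h η * g η ∂μ - (∫ η, h η ∂μ) * ∫ σ, g σ ∂μ := by rw [hI1, hI2]
    have hcov2 : ∫ σ, spinAt 0 σ * h σ ∂μ - (∫ σ, spinAt 0 σ ∂μ) * ∫ η, h η ∂μ =
        ∫ η, h η ^ 2 ∂μ - (∫ η, h η ∂μ) ^ 2 := by
      rw [hI3, hI2]
      simp only [sq]
    -- the pair hypothesis for `(h, g)` and the induction hypothesis for `h`
    have hpair' := hpair R hRr h g hhdep hg
    have hih := ih h hhdep
    rw [hcov2] at hih
    have hVσ := forgettingComposes_var_nonneg (μ := μ) hσm hσb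
    have hVh := forgettingComposes_var_nonneg (μ := μ) hhm hCh
    have hVg := forgettingComposes_var_nonneg (μ := μ) hgm hCg
    rw [hcov]
    -- arithmetic: `Var h ≤ θ^k Var σ₀`, then chain
    generalize (∫ σ, spinAt 0 σ ^ 2 ∂μ - (∫ σ, spinAt 0 σ ∂μ) ^ 2) = Vs at hih hVσ ⊢
    generalize (∫ η, h η ^ 2 ∂μ - (∫ η, h η ∂μ) ^ 2) = Vh at hih hpair' hVh ⊢
    generalize (∫ σ, g σ ^ 2 ∂μ - (∫ σ, g σ ∂μ) ^ 2) = Vg at hpair' hVg ⊢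
    generalize (∫ η, h η * g η ∂μ - (∫ η, h η ∂μ) * ∫ σ, g σ ∂μ) = Cv at hpair' ⊢
    have hVh_le : Vh ≤ θ ^ k * Vs := by
      rcases hVh.eq_or_lt with h0 | hpos
      · rw [← h0]
        exact mul_nonneg (pow_nonneg hθ k) hVσ
      · exact le_of_mul_le_mul_right (by nlinarith [hih]) hpos
    calc Cv ^ 2 ≤ θ * Vh * Vg := hpair'
      _ ≤ θ * (θ ^ k * Vs) * Vg :=
          mul_le_mul_of_nonneg_right (mul_le_mul_of_nonneg_left hVh_le hθ) hVg
      _ = θ ^ (k + 1) * Vs * Vg := by ring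

end Summit.CriticalPhenomena.Ising3DConformalLimit.Theorems
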